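import Summits.ResolutionOfSingularities.ResolutionOfSingularities.Theorems.PurelyInseparableDim4PureLeafGlobalWinTheorem
import HarnessLib
import HarnessLib.Audit.Tags

/-!
# Purely inseparable fourfolds — UNIT LEAVES `x^a·(1+x_j)` WITH `a_j` EVEN WIN THE PLAIN GLOBAL GAME over `𝔽₂`
# (cell res-dim4-pi; brick (δ) «product class 𝓤», FILE 1: the «grind» sub-class; CONFIGS (2,2) unit-leaf row)
# [OURS · counted 0 · a theorem about OUR coordinate-centre frame v4, not about resolution]

Width seat `res-dim4-p-10` (g4).  The desk's census row (WORD #159) of the 81 unit leaves `x^a(1+x₀)`,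
`a ∈ {1,2,3}⁴`, records the PLAIN game (`StateWins 2`, every permissible coordinate centre for A, every
`𝔽₂`-rational reply of the tree's `Edge` for B) as «an A-win wherever decided (45/81)», the rest undecided by two
engines at depth ≤ 8.  This file proves a UNIFORM theorem covering every exponent vector whose unit-variable
exponent is EVEN — among the census leaves the 27 with `a₀ = 2`, including `2333`, undecided by both engines:

* **`stateWins_grind_classes`** — for a fixed variable `x_j`, the two-sorted class
  (GU) products `N(a,e) = ∏ xᵢ^{aᵢ}(1+xᵢ)^{eᵢ}` with `e_j = 1`, `a_j` EVEN, and every other variable MONIC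
  (`a_k = 0 ∨ e_k = 0`), and (GL) L-states `N(a,e)·(∏_{i∈T}(1+xᵢ)+1)` with all exponents even, `j ∈ T`,
  `|T| ≥ 2`, `e_j = 0`, `a_k = 0` on `T ∖ {j}`, monic off `j`, is contained in A's attractor, every booking.
  A's strategy: GRIND `x_j` FIRST — the singleton centre `{x_j}` while `a_j ≥ 2` (B's replies keep `b_j = 0`, so
  the dressed variable `x_j^{a_j}(1+x_j)` is never translated, and the monic variables only swap
  `x_k^m ↔ (1+x_k)^m`); by p-10 g2's transition algebra (`step_F_of_purelyOdd`, `step_F_of_forall_even`,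
  `prod_sub_eq_mul_L`, `step_F_L_exit`, `step_F_L_persist`) every cleaned successor is again in (GU) ∪ (GL)
  with `a_j` lowered by `2`, or is already a member of D3b's class; at `a_j = 0` the state IS a member of D3b's
  class ((I5)/(I6) resp. the L-class of `…PureLeafGlobalWinTheorem`, p684251) and `stateWins_prod_class` /
  `stateWins_L_class` finish.  Induction on `a_j / 2`.
* **`stateWins_prod_unitEven`**, **`stateWins_L_unitEven`** — the two sorts, hypothesis-by-hypothesis;
* **`stateWins_unitLeaf_even`** — `∀ j a, a_j even ⇒ ∀ r exc, StateWins 2 ⟨x^a·(1+x_j), r, exc⟩` over `𝔽₂`.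

What is NOT here: `a_j` ODD (the grind ends at the symmetric dressed factor `x_j(1+x_j)`; there B has located
defences through the mixed unit `1 + x_j x_k` — seat memo `pub/res-dim4/res-dim4-p-10/UNIT-CLASS-TEXT.md`; no claim).
Riders: `𝔽₂`-rational replies only (the game over `ZMod 2`); plain game, not MODE 1h (MODE 1h from unit leaves
can diverge: `…PureLeafUnitDivergence`); NOT F4-C(2,2).  Nothing here proves resolution of singularities in
dimension ≥ 4 / characteristic `p`; counted 0; AI work, weaker than expert review.
bears_on: LADDER-RESOLUTION:D157-DOOR2 (res-dim4-pi · brick (δ) · CONFIGS unit-leaf row). Supports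
stmt-ResolutionOfSingularities-16155 (helper).
-/

set_option linter.dupNamespace false

open MvPolynomial Finset

open scoped BigOperators

noncomputable section

namespace Summit.ResolutionOfSingularities.ResolutionOfSingularities.Theorems.PIDim4

namespace PureLeafNF

open Literature.AlgebraicGeometry.Resolution
open Literature.AlgebraicGeometry.Resolution.Hauser2010
open CentreBlowup PthPowerFactor

/-! ## 1. Bookkeeping of the chart-and-swap off the ground variable -/

/-- Off the chart variable `x_j` the chart-and-swap of a singleton move either keeps `(a_k, e_k)` or swaps it. [folklore] -/
theorem chartSwap_of_ne (a e : Fin 4 → ℕ) {j k : Fin 4} (hkj : k ≠ j) (b : Fin 4 → ZMod 2) :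
    ((if b k = 0 then Function.update a j (a j - 2) k else e k) = a k ∧
      (if b k = 0 then e k else Function.update a j (a j - 2) k) = e k) ∨
    ((if b k = 0 then Function.update a j (a j - 2) k else e k) = e k ∧
      (if b k = 0 then e k else Function.update a j (a j - 2) k) = a k) := by
  rw [Function.update_of_ne hkj]
  by_cases hb : b k = 0
  · left; rw [if_pos hb, if_pos hb]; exact ⟨rfl, rfl⟩
  · right; rw [if_neg hb, if_neg hb]; exact ⟨rfl, rfl⟩

/-- **Monic variables stay monic** under the chart-and-swap (`a_k = 0 ∨ e_k = 0` for `k ≠ j`). [folklore] -/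
theorem monic_chartSwap (a e : Fin 4 → ℕ) (j : Fin 4) (hmon : ∀ k, k ≠ j → a k = 0 ∨ e k = 0)
    (b : Fin 4 → ZMod 2) : ∀ k, k ≠ j →
      (if b k = 0 then Function.update a j (a j - 2) k else e k) = 0 ∨
      (if b k = 0 then e k else Function.update a j (a j - 2) k) = 0 := by
  intro k hk
  rcases chartSwap_of_ne a e hk b with ⟨h1, h2⟩ | ⟨h1, h2⟩ <;> rw [h1, h2]
  · exact hmon k hk
  · exact (hmon k hk).symm

/-! ## 2. The base of the grind: `a_j = 0` is D3b's class -/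

/-- (GU) with `a_j = 0`: a product with `x_j`-factor `(1+x_j)^{e_j}` and monic other variables satisfies (I5), (I6). [folklore] -/
theorem stateWins_prod_grind_base (a e : Fin 4 → ℕ) (j : Fin 4) (hj0 : a j = 0)
    (hmon : ∀ k, k ≠ j → a k = 0 ∨ e k = 0) (r : Fin 4 →₀ ℕ) (exc : Finset (Fin 4)) :
    StateWins 2 (⟨∏ i, X i ^ a i * (1 + X i) ^ e i, r, exc⟩ : State (ZMod 2)) := by
  refine stateWins_prod_class a e (fun i hi => ?_) (fun i hi hpos i' _ => ?_) r exc
  · by_cases hij : i = j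
    · rw [hij]; exact hj0
    · rcases hmon i hij with h | h
      · exact h
      · rw [h] at hi; exact absurd hi (by decide)
  · exfalso
    by_cases hij : i = j
    · rw [hij, hj0] at hi; exact absurd hi (by decide)
    · rcases hmon i hij with h | h
      · rw [h] at hi; exact absurd hi (by decide)
      · rw [h] at hpos; exact Nat.lt_irrefl 0 hpos

/-- (GL) with `a_j = 0`: an L-state with `a = 0` on `T`, D3b's L-class. [folklore] -/
theorem stateWins_L_grind_base (a e : Fin 4 → ℕ) (T : Finset (Fin 4)) (j : Fin 4) (hj0 : a j = 0)
    (ha : ∀ i, a i % 2 = 0) (he : ∀ i, e i % 2 = 0) (hT : 2 ≤ T.card) (haT : ∀ k ∈ T, k ≠ j → a k = 0)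
    (r : Fin 4 →₀ ℕ) (exc : Finset (Fin 4)) :
    StateWins 2 (⟨(∏ i, X i ^ a i * (1 + X i) ^ e i) *
      ((∏ i, X i ^ (0 : ℕ) * (1 + X i) ^ (if i ∈ T then 1 else 0) : MvPolynomial (Fin 4) (ZMod 2)) + 1),
      r, exc⟩ : State (ZMod 2)) :=
  stateWins_L_class a e T ha he (fun i hi => by
    by_cases hij : i = j
    · rw [hij]; exact hj0
    · exact haT i hi hij) hT r exc

/-! ## 3. The grind: induction on `a_j / 2` -/

/-- **THE GRIND CLASS IS WINNING.** For the ground variable `x_j` and every `n`: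
(GU) every product `N(a,e)` over `𝔽₂` with `a_j ≤ 2n` even, `e_j = 1` and monic other variables is an A-win of the
plain global game at `q = 2`, every booking; (GL) every L-state `N(a,e)·(∏_{T}(1+xᵢ)+1)` with all exponents even,
`a_j ≤ 2n`, `j ∈ T`, `|T| ≥ 2`, `e_j = 0`, `a = 0` on `T ∖ {j}` and monic other variables likewise.
[OURS · counted 0] [folklore] -/
theorem stateWins_grind_classes (j : Fin 4) : ∀ n : ℕ,
    (∀ (a e : Fin 4 → ℕ), a j ≤ 2 * n → a j % 2 = 0 → e j = 1 →
      (∀ k, k ≠ j → a k = 0 ∨ e k = 0) →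
      ∀ (r : Fin 4 →₀ ℕ) (exc : Finset (Fin 4)),
        StateWins 2 (⟨∏ i, X i ^ a i * (1 + X i) ^ e i, r, exc⟩ : State (ZMod 2))) ∧
    (∀ (a e : Fin 4 → ℕ) (T : Finset (Fin 4)), a j ≤ 2 * n →
      (∀ i, a i % 2 = 0) → (∀ i, e i % 2 = 0) → j ∈ T → 2 ≤ T.card → e j = 0 →
      (∀ k ∈ T, k ≠ j → a k = 0) → (∀ k, k ≠ j → a k = 0 ∨ e k = 0) →
      ∀ (r : Fin 4 →₀ ℕ) (exc : Finset (Fin 4)),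
        StateWins 2 (⟨(∏ i, X i ^ a i * (1 + X i) ^ e i) *
          ((∏ i, X i ^ (0 : ℕ) * (1 + X i) ^ (if i ∈ T then 1 else 0) : MvPolynomial (Fin 4) (ZMod 2)) + 1),
          r, exc⟩ : State (ZMod 2))) := by
  intro n
  induction n with
  | zero =>
    exact ⟨fun a e hle _ _ hmon r exc => stateWins_prod_grind_base a e j (by omega) hmon r exc,
      fun a e T hle ha he _ hT _ haT _ r exc => stateWins_L_grind_base a e T j (by omega) ha he hT haT r exc⟩
  | succ n IH =>
    have hstate : ∀ t : State (ZMod 2), t = ⟨t.F, t.r, t.exc⟩ := fun t => rfl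
    refine ⟨fun a e hle hev hej hmon r exc => ?_, fun a e T hle ha he hjT hT hej0 haT hmon r exc => ?_⟩
    · -- (GU)
      by_cases hj0 : a j = 0
      · exact stateWins_prod_grind_base a e j hj0 hmon r exc
      have hj2 : 2 ≤ a j := by omega
      unfold StateWins
      refine Game.Wins.move (m := ({j} : Finset (Fin 4))) ⟨Finset.singleton_nonempty j, ?_⟩ ?_
      · show (2 : ℕ∞) ≤ ordAlong {j} (∏ i, X i ^ a i * (1 + X i) ^ e i : MvPolynomial (Fin 4) (ZMod 2))
        rw [ordAlong_prod, degIn_singleton]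
        exact_mod_cast hj2
      rintro s' ⟨j', b, hj', hbj, -, hne, rfl⟩
      rw [Finset.mem_singleton] at hj'
      subst hj'
      rw [hstate (step 2 {j'} j' b _)]
      by_cases hex : ∃ k, (if b k = 0 then Function.update a j' (a j' - 2) k else e k) % 2 = 1 ∧
          (if b k = 0 then e k else Function.update a j' (a j' - 2) k) % 2 = 0
      · -- (α) a purely odd variable survives: the successor is the literal product, again in (GU)
        obtain ⟨k, hak, hek⟩ := hex
        rw [step_F_of_purelyOdd _ a e rfl hj2 b hak hek]
        refine IH.1 _ _ ?_ ?_ ?_ (monic_chartSwap a e j' hmon b) _ _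
        · show (if b j' = 0 then Function.update a j' (a j' - 2) j' else e j') ≤ 2 * n
          rw [if_pos hbj, Function.update_self]; omega
        · show (if b j' = 0 then Function.update a j' (a j' - 2) j' else e j') % 2 = 0
          rw [if_pos hbj, Function.update_self]; omega
        · show (if b j' = 0 then e j' else Function.update a j' (a j' - 2) j') = 1
          rw [if_pos hbj]; exact hej
      · -- (β) every new `a` is even: the cleaning produces `N(a′,ê′)·(∏_{e′ odd}(1+xᵢ) − 1)`
        have hall : ∀ i, (if b i = 0 then Function.update a j' (a j' - 2) i else e i) % 2 = 0 := by
          intro i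
          by_contra hodd
          by_cases hij : i = j'
          · rw [hij, if_pos hbj, Function.update_self] at hodd; omega
          · refine hex ⟨i, by omega, ?_⟩
            rcases monic_chartSwap a e j' hmon b i hij with h0 | h0
            · rw [h0] at hodd; exact absurd rfl hodd
            · rw [h0]
        rw [step_F_of_forall_even _ a e rfl hj2 b hall, prod_sub_eq_mul_L]
        have hmem : j' ∈ Finset.univ.filter
            (fun i => (if b i = 0 then e i else Function.update a j' (a j' - 2) i) % 2 = 1) := by
          rw [Finset.mem_filter]; refine ⟨Finset.mem_univ _, ?_⟩; rw [if_pos hbj, hej]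
        by_cases hT : 2 ≤ (Finset.univ.filter
            (fun i => (if b i = 0 then e i else Function.update a j' (a j' - 2) i) % 2 = 1)).card
        · -- an L-state of sort (GL) is born
          rw [prod_filter_sub_one_eq_bracket]
          refine IH.2 _ _ _ ?_ hall (fun i => ?_) hmem hT ?_ (fun k hk hkj => ?_) (fun k hkj => ?_) _ _
          · show (if b j' = 0 then Function.update a j' (a j' - 2) j' else e j') ≤ 2 * n
            rw [if_pos hbj, Function.update_self]; omega
          · show ((if b i = 0 then e i else Function.update a j' (a j' - 2) i) -
              (if b i = 0 then e i else Function.update a j' (a j' - 2) i) % 2) % 2 = 0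
            omega
          · show (if b j' = 0 then e j' else Function.update a j' (a j' - 2) j') -
              (if b j' = 0 then e j' else Function.update a j' (a j' - 2) j') % 2 = 0
            rw [if_pos hbj, hej]
          · have hodd := (Finset.mem_filter.mp hk).2
            rcases monic_chartSwap a e j' hmon b k hkj with h0 | h0
            · exact h0
            · rw [h0] at hodd; exact absurd hodd (by decide)
          · rcases monic_chartSwap a e j' hmon b k hkj with h0 | h0
            · exact Or.inl h0
            · right
              show (if b k = 0 then e k else Function.update a j' (a j' - 2) k) -
                (if b k = 0 then e k else Function.update a j' (a j' - 2) k) % 2 = 0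
              rw [h0]
        · -- exactly one odd `e′` (namely at `j'`): the cleaning re-creates the pure factor `x_{j'}` — D3b's class
          have hk : Finset.univ.filter
              (fun i => (if b i = 0 then e i else Function.update a j' (a j' - 2) i) % 2 = 1) = {j'} := by
            refine Finset.eq_singleton_iff_unique_mem.mpr ⟨hmem, fun i hi => ?_⟩
            by_contra hne'
            exact hT (Finset.one_lt_card.mpr ⟨j', hmem, i, hi, fun h => hne' h.symm⟩)
          rw [prod_filter_sub_one_eq_X _ hk, X_eq_prod j', prod_mul_prod]
          refine stateWins_prod_class _ _ (fun i hi => ?_) (fun i hi _ i' hi' => ⟨?_, ?_⟩) _ _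
          · exfalso
            revert hi
            show ¬ ((if b i = 0 then e i else Function.update a j' (a j' - 2) i) -
              (if b i = 0 then e i else Function.update a j' (a j' - 2) i) % 2 + 0) % 2 = 1
            omega
          · show ((if b i' = 0 then Function.update a j' (a j' - 2) i' else e i') +
              (if i' = j' then 1 else 0)) % 2 = 0
            by_cases hij' : i' = j'
            · exfalso
              have hii : ¬ (i = j') := fun h => hi' (hij'.trans h.symm)
              revert hi
              show ¬ ((if b i = 0 then Function.update a j' (a j' - 2) i else e i) +
                (if i = j' then 1 else 0)) % 2 = 1
              rw [if_neg hii, add_zero]; have := hall i; omega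
            · rw [if_neg hij', add_zero]; exact hall i'
          · show ((if b i' = 0 then e i' else Function.update a j' (a j' - 2) i') -
              (if b i' = 0 then e i' else Function.update a j' (a j' - 2) i') % 2 + 0) % 2 = 0
            omega
    · -- (GL)
      by_cases hj0 : a j = 0
      · exact stateWins_L_grind_base a e T j hj0 ha he hT haT r exc
      have hj2 : 2 ≤ a j := by have := ha j; omega
      unfold StateWins
      refine Game.Wins.move (m := ({j} : Finset (Fin 4)))
        ⟨Finset.singleton_nonempty j, two_le_ordAlong_singleton_prod_mul a e hj2 _⟩ ?_
      rintro s' ⟨j', b, hj', hbj, -, hne, rfl⟩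
      rw [Finset.mem_singleton] at hj'
      subst hj'
      rw [hstate (step 2 {j'} j' b _)]
      by_cases hex : ∃ k ∈ T, b k ≠ 0
      · -- exit: a bracket variable is translated, the successor is a (GU) product
        obtain ⟨k, hkT, hbk⟩ := hex
        rw [step_F_L_exit _ a e ha he T rfl hj2 b hkT hbk]
        have hjn : j' ∉ T.filter (fun i => b i ≠ 0) := fun h => (Finset.mem_filter.mp h).2 hbj
        have hjm : j' ∈ T.filter (fun i => b i = 0) := Finset.mem_filter.mpr ⟨hjT, hbj⟩
        refine IH.1 _ _ ?_ ?_ ?_ (fun k' hk' => ?_) _ _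
        · show (if b j' = 0 then Function.update a j' (a j' - 2) j' else e j') +
            (if j' ∈ T.filter (fun i => b i ≠ 0) then 1 else 0) ≤ 2 * n
          rw [if_pos hbj, Function.update_self, if_neg hjn]; omega
        · show ((if b j' = 0 then Function.update a j' (a j' - 2) j' else e j') +
            (if j' ∈ T.filter (fun i => b i ≠ 0) then 1 else 0)) % 2 = 0
          rw [if_pos hbj, Function.update_self, if_neg hjn]; have := ha j'; omega
        · show (if b j' = 0 then e j' else Function.update a j' (a j' - 2) j') +
            (if j' ∈ T.filter (fun i => b i = 0) then 1 else 0) = 1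
          rw [if_pos hbj, if_pos hjm, hej0]
        · show (if b k' = 0 then Function.update a j' (a j' - 2) k' else e k') +
              (if k' ∈ T.filter (fun i => b i ≠ 0) then 1 else 0) = 0 ∨
            (if b k' = 0 then e k' else Function.update a j' (a j' - 2) k') +
              (if k' ∈ T.filter (fun i => b i = 0) then 1 else 0) = 0
          rw [Function.update_of_ne hk']
          by_cases hb : b k' = 0
          · have h1 : k' ∉ T.filter (fun i => b i ≠ 0) := fun h => (Finset.mem_filter.mp h).2 hb
            rw [if_pos hb, if_pos hb, if_neg h1, add_zero]
            by_cases hkT' : k' ∈ T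
            · exact Or.inl (haT k' hkT' hk')
            · have h2 : k' ∉ T.filter (fun i => b i = 0) := fun h => hkT' (Finset.mem_filter.mp h).1
              rw [if_neg h2, add_zero]; exact hmon k' hk'
          · have h1 : k' ∉ T.filter (fun i => b i = 0) := fun h => hb (Finset.mem_filter.mp h).2
            rw [if_neg hb, if_neg hb, if_neg h1, add_zero]
            by_cases hkT' : k' ∈ T
            · exact Or.inr (haT k' hkT' hk')
            · have h2 : k' ∉ T.filter (fun i => b i ≠ 0) := fun h => hkT' (Finset.mem_filter.mp h).1
              rw [if_neg h2, add_zero]; exact (hmon k' hk').symm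
      · -- persist: the same bracket, `a_{j'}` lowered by two
        push Not at hex
        rw [step_F_L_persist _ a e ha he T rfl hj2 b hex]
        obtain ⟨ha'', he''⟩ := even_chartSwap ha he j' b
        refine IH.2 _ _ T ?_ ha'' he'' hjT hT ?_ (fun k hkT hkj => ?_) (monic_chartSwap a e j' hmon b) _ _
        · show (if b j' = 0 then Function.update a j' (a j' - 2) j' else e j') ≤ 2 * n
          rw [if_pos hbj, Function.update_self]; omega
        · show (if b j' = 0 then e j' else Function.update a j' (a j' - 2) j') = 0
          rw [if_pos hbj]; exact hej0
        · show (if b k = 0 then Function.update a j' (a j' - 2) k else e k) = 0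
          rw [if_pos (hex k hkT), Function.update_of_ne hkj]; exact haT k hkT hkj

/-! ## 4. Headline forms -/

/-- **(GU) products win**: `e_j = 1`, `a_j` even, other variables monic ⇒ `StateWins 2 ⟨N(a,e), r, exc⟩` over `𝔽₂`.
[OURS · counted 0] [folklore] -/
theorem stateWins_prod_unitEven (j : Fin 4) (a e : Fin 4 → ℕ) (hev : a j % 2 = 0) (hej : e j = 1)
    (hmon : ∀ k, k ≠ j → a k = 0 ∨ e k = 0) (r : Fin 4 →₀ ℕ) (exc : Finset (Fin 4)) :
    StateWins 2 (⟨∏ i, X i ^ a i * (1 + X i) ^ e i, r, exc⟩ : State (ZMod 2)) :=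
  (stateWins_grind_classes j (a j)).1 a e (by omega) hev hej hmon r exc

/-- **(GL) L-states win**: all exponents even, `j ∈ T`, `|T| ≥ 2`, `e_j = 0`, `a = 0` on `T ∖ {j}`, monic off `j`.
[OURS · counted 0] [folklore] -/
theorem stateWins_L_unitEven (j : Fin 4) (a e : Fin 4 → ℕ) (T : Finset (Fin 4)) (ha : ∀ i, a i % 2 = 0)
    (he : ∀ i, e i % 2 = 0) (hjT : j ∈ T) (hT : 2 ≤ T.card) (hej0 : e j = 0)
    (haT : ∀ k ∈ T, k ≠ j → a k = 0) (hmon : ∀ k, k ≠ j → a k = 0 ∨ e k = 0)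
    (r : Fin 4 →₀ ℕ) (exc : Finset (Fin 4)) :
    StateWins 2 (⟨(∏ i, X i ^ a i * (1 + X i) ^ e i) *
      ((∏ i, X i ^ (0 : ℕ) * (1 + X i) ^ (if i ∈ T then 1 else 0) : MvPolynomial (Fin 4) (ZMod 2)) + 1),
      r, exc⟩ : State (ZMod 2)) :=
  (stateWins_grind_classes j (a j)).2 a e T (by omega) ha he hjT hT hej0 haT hmon r exc

/-- `N(a, δ_j) = x^a · (1 + x_j)`. [folklore] -/
theorem prod_indicator_eq_monomial_mul (j : Fin 4) (a : Fin 4 → ℕ) :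
    (∏ i, X i ^ a i * (1 + X i) ^ (if i = j then 1 else 0) : MvPolynomial (Fin 4) (ZMod 2)) =
      monomial (Finsupp.equivFunOnFinite.symm a) 1 * (1 + X j) := by
  rw [prod_eq_monomial_mul]
  congr 1
  rw [← Finset.mul_prod_erase Finset.univ _ (Finset.mem_univ j), if_pos rfl, pow_one,
    Finset.prod_eq_one (fun i hi => by rw [if_neg (Finset.ne_of_mem_erase hi), pow_zero]), mul_one]

/-- **EVERY UNIT LEAF `x^a·(1+x_j)` WITH `a_j` EVEN WINS THE PLAIN GLOBAL GAME OVER `𝔽₂`** (`q = 2`; every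
exponent vector `a` with `a_j` even, every booking `(r, exc)`): `StateWins 2 ⟨x^a(1+x_j), r, exc⟩`.
[OURS · counted 0] [folklore] -/
theorem stateWins_unitLeaf_even (j : Fin 4) (a : Fin 4 → ℕ) (hev : a j % 2 = 0)
    (r : Fin 4 →₀ ℕ) (exc : Finset (Fin 4)) :
    StateWins 2 (⟨monomial (Finsupp.equivFunOnFinite.symm a) 1 * (1 + X j), r, exc⟩ : State (ZMod 2)) := by
  have h := stateWins_prod_unitEven j a (fun i => if i = j then 1 else 0) hev (if_pos rfl)
    (fun k hk => Or.inr (if_neg hk)) r exc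
  rwa [prod_indicator_eq_monomial_mul] at h

/-- The same with the leaf written as `x^a + x^{a + δ_j}`. [OURS · counted 0] [folklore] -/
theorem stateWins_monomial_add_monomial_even (j : Fin 4) (a : Fin 4 → ℕ) (hev : a j % 2 = 0)
    (r : Fin 4 →₀ ℕ) (exc : Finset (Fin 4)) :
    StateWins 2 (⟨monomial (Finsupp.equivFunOnFinite.symm a) 1 +
      monomial (Finsupp.equivFunOnFinite.symm a + Finsupp.single j 1) 1, r, exc⟩ : State (ZMod 2)) := by
  have h := stateWins_unitLeaf_even j a hev r exc
  rwa [mul_add, mul_one, X, monomial_mul, one_mul] at h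

end PureLeafNF

end Summit.ResolutionOfSingularities.ResolutionOfSingularities.Theorems.PIDim4

end
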